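import Mathlib
import Literature.Analysis.FluidPDE.FluidComputer.GalerkinEnergyBalance
import Literature.Analysis.FluidPDE.FluidComputer.EnstrophyCurvature
import Summits.NavierStokesRegularity.FluidComputer.SparseGalerkinCeiling
import HarnessLib

/-!
# The sparse-support ceiling for the tree's Galerkin Navier–Stokes system — all dyadic steps

HONEST FRAMING (cell `ns-blowup`, seat `ns-blowup-circuit`, human ruling D-0035): this cell
ATTEMPTS the negative direction of the Clay problem; nothing in this file is a claim about
Navier–Stokes blow-up. WHAT THIS IS NOT: not a statement about the untruncated equations.
Companion of `SparseGalerkinCeiling` (one dyadic step, `galerkin_sparse_step`): this file iterates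
the step over dyadic levels for the FORCED Galerkin system `IsGalerkinSolution U S ν c f` of
`Literature.Analysis.FluidPDE.FluidComputer.GalerkinEnergyBalance` (true `(u·∇)u` coefficients on a
finite mode set `S ⊆ ℤ³`, arbitrary pressure multipliers, force), giving the finite-truncation form of
memo Theorem A / CLAIM C1–C1′ (`run/shared/lean/pub/ns-blowup/CIRCUIT-OBSTRUCTIONS.md` §A.3 (5), §G.2):
above a threshold `R₀`, SPARSENESS `(2√E₀/ν)·√D_k/|k| ≤ q < 1` forces
`|û(t,k)| ≤ q^j √E₀ + (β + β')/(1 − q)` at dyadic level `j`, uniformly in `T` and in `#S`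
(`β` = data tail, `β'` = force tail in units of `ν|k|²`).

Typed: `sqrt_two_mul_modalEnergy_le` (a mode is bounded by the energy budget) and
`galerkin_sparse_ceiling` (the iterated ceiling; the geometric recursion is solved inline).
Honest limits: finite `S`; the limit `S ↑ S_∞` and the continuation criterion are the PDE half of
Theorem A (memo §A.3 (5); refereed PASS as NS-verbatim).
-/

namespace Summit.NavierStokesRegularity.FluidComputer.SparseGalerkinCeiling

open Set Finset Literature.Analysis.FluidPDE.FluidComputer Literature.Analysis.FluidPDE.FluidComputer.ShellTransfer
open scoped ComplexConjugate

/-! ## All dyadic steps: the ceiling for the Galerkin system -/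

/-- A single mode is bounded by the square root of the energy budget. -/
theorem sqrt_two_mul_modalEnergy_le {U : FourierVelocity} {S : Finset (Fin 3 → ℤ)} {E₀ : ℝ}
    (hE : ∑ k ∈ S, 2 * modalEnergy U k ≤ E₀) {k : Fin 3 → ℤ} (hk : k ∈ S) :
    Real.sqrt (2 * modalEnergy U k) ≤ Real.sqrt E₀ := by
  refine Real.sqrt_le_sqrt ((Finset.single_le_sum (fun q _ => ?_) hk).trans hE)
  have := modalEnergy_nonneg U q; linarith

/-- **THE SPARSE-SUPPORT CEILING FOR THE TREE'S FORCED GALERKIN NAVIER–STOKES SYSTEM** (memo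
Theorem A, all dyadic steps, uniform floor; finite-truncation form of CLAIM C1/C1′). Let `U` solve
`IsGalerkinSolution U S ν c f`, supported in `S`, `ν > 0`; on `[0,T)` let `Σ_{k∈S}|û(t,k)|² ≤ E₀`
and, above a threshold wavenumber `R₀ > 0`: data `|û(0,k)| ≤ β`, force `|f̂(t,k)| ≤ β'·ν|k|²`, and
SPARSENESS `|k|·2√E₀·√D_k ≤ q·ν|k|²` (`D_k = #{p ∈ S : k-p ∈ S}`, i.e. `(2√E₀/ν)√D_k/|k| ≤ q`) with a
ratio `q < 1`. Then at every dyadic level `j` — every `k ∈ S` with `2^j R₀ ≤ |k|` — and every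
`t ∈ [0,T)`: `|û(t,k)| ≤ q^j·√E₀ + (β + β')/(1 - q)`. Constants are independent of `T` and of `#S`:
the amplitudes decay like `|k|^{-log₂(1/q)}` down to the data/force floor, uniformly in the
truncation — iterate with `R₀ ↦ 2^m R₀` for superpolynomial decay (memo §A.3 (5)). -/
theorem galerkin_sparse_ceiling {U : ℝ → FourierVelocity} {S : Finset (Fin 3 → ℤ)} {ν : ℝ}
    {c : ℝ → (Fin 3 → ℤ) → ℂ} {f : ℝ → (Fin 3 → ℤ) → Fin 3 → ℂ}
    (hU : IsGalerkinSolution U S ν c f) (hsupp : IsSupportedOn U S) (hν : 0 < ν)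
    {T E₀ R₀ q β β' : ℝ} {φ : (Fin 3 → ℤ) → ℝ}
    (henergy : ∀ t ∈ Ico 0 T, ∑ k ∈ S, 2 * modalEnergy (U t) k ≤ E₀)
    (hforce : ∀ t ∈ Ico 0 T, ∀ k ∈ S, Real.sqrt (∑ j, Complex.normSq (f t k j)) ≤ φ k)
    (hR₀ : 0 < R₀) (hq0 : 0 ≤ q) (hq1 : q < 1) (hβ : 0 ≤ β) (hβ' : 0 ≤ β')
    (hdata : ∀ k ∈ S, R₀ ≤ Real.sqrt (knormSq k) → Real.sqrt (2 * modalEnergy (U 0) k) ≤ β)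
    (hφ : ∀ k ∈ S, R₀ ≤ Real.sqrt (knormSq k) → φ k ≤ β' * (ν * knormSq k))
    (hsparse : ∀ k ∈ S, R₀ ≤ Real.sqrt (knormSq k) →
      Real.sqrt (knormSq k) * (2 * Real.sqrt E₀ * Real.sqrt (S.filter (fun p => k - p ∈ S)).card)
        ≤ q * (ν * knormSq k)) :
    ∀ j : ℕ, ∀ k ∈ S, 2 ^ j * R₀ ≤ Real.sqrt (knormSq k) → ∀ t ∈ Ico 0 T,
      Real.sqrt (2 * modalEnergy (U t) k) ≤ q ^ j * Real.sqrt E₀ + (β + β') / (1 - q) := by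
  classical
  let A : ℕ → ℝ := fun j => Nat.rec (Real.sqrt E₀) (fun _ a => (β + β') + q * a) j
  have hA0 : A 0 = Real.sqrt E₀ := rfl
  have hAsucc : ∀ j, A (j + 1) = (β + β') + q * A j := fun j => rfl
  have hApos : ∀ j, 0 ≤ A j := by
    intro j
    induction j with
    | zero => rw [hA0]; exact Real.sqrt_nonneg _
    | succ j ih => rw [hAsucc]; positivity
  have key : ∀ j : ℕ, ∀ k ∈ S, 2 ^ j * R₀ ≤ Real.sqrt (knormSq k) → ∀ t ∈ Ico 0 T,
      Real.sqrt (2 * modalEnergy (U t) k) ≤ A j := by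
    intro j
    induction j with
    | zero =>
      intro k hk _ t ht
      rw [hA0]
      exact sqrt_two_mul_modalEnergy_le (henergy t ht) hk
    | succ j ih =>
      intro k hk hRk t ht
      have hRpos : 0 < (2 : ℝ) ^ (j + 1) * R₀ := by positivity
      have hstep := galerkin_sparse_step hU hsupp hν (R := 2 ^ (j + 1) * R₀) (A := A j)
        henergy hforce hRpos (hApos j) (by
          intro s hs q' hq' hRq'
          refine ih q' hq' ?_ s hs
          have : (2 : ℝ) ^ (j + 1) * R₀ = 2 * (2 ^ j * R₀) := by ring
          linarith) k hk hRk t (Ico_subset_Icc_self ht)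
      have hκ : R₀ ≤ Real.sqrt (knormSq k) := by
        have h2 : (1 : ℝ) ≤ 2 ^ (j + 1) := one_le_pow₀ (by norm_num)
        nlinarith
      have hκ2 : 0 < ν * knormSq k := by
        have h1 : 0 < Real.sqrt (knormSq k) := lt_of_lt_of_le hR₀ hκ
        exact mul_pos hν (Real.sqrt_pos.mp h1)
      rw [hAsucc]
      refine hstep.trans (max_le ?_ ?_)
      · have := hdata k hk hκ
        have := hApos j
        nlinarith
      · rw [div_le_iff₀ hκ2]
        have h1 := mul_le_mul_of_nonneg_right (hsparse k hk hκ) (hApos j)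
        have h2 := hφ k hk hκ
        nlinarith
  -- solve the recursion A (j+1) = (β+β') + q·A j explicitly (geometric series bound)
  have h1q : 0 < 1 - q := sub_pos.mpr hq1
  have hgeo : ∀ j, A j ≤ q ^ j * Real.sqrt E₀ + (β + β') / (1 - q) := by
    intro j
    induction j with
    | zero =>
      have h0 : 0 ≤ (β + β') / (1 - q) := div_nonneg (by positivity) h1q.le
      rw [hA0, pow_zero, one_mul]
      linarith
    | succ j ih =>
      rw [hAsucc]
      calc β + β' + q * A j ≤ β + β' + q * (q ^ j * Real.sqrt E₀ + (β + β') / (1 - q)) := by gcongr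
        _ = q ^ (j + 1) * Real.sqrt E₀ + (β + β' + q * ((β + β') / (1 - q))) := by ring
        _ = q ^ (j + 1) * Real.sqrt E₀ + (β + β') / (1 - q) := by
            congr 1
            field_simp
            ring
  intro j k hk hRk t ht
  exact (key j k hk hRk t ht).trans (hgeo j)

end Summit.NavierStokesRegularity.FluidComputer.SparseGalerkinCeiling
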